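import Mathlib
import HarnessLib
import Literature.Combinatorics.Enumerative.DougallSummation
import Summits.KontsevichZagierPeriods.Zeta5Search.HypergeometricWhipple

/-!
# ζ(5) search — Dougall's TERMINATING very-well-poised `₅F₄` sum in Gamma form over `ℂ` (cell `pub-zeta5`, ct-1 g26)

HONEST FRAMING: systematic search; no irrationality claim unless kernel-certified.  An identity of special functions
(a finite hypergeometric sum); nothing here is an irrationality result; it discharges no named fact by itself.

Brick B5a of the lineage's blueprint `HOME/ct-1/g26/VWP-BLUEPRINT.md` for `Zudilin2002.vwp_eq_integral_of_pos`: the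
«agreement at the integers» input of the Carlson step B5.  Zudilin's (9) [math/0206177, Lemma 1] is the NON-terminating
Dougall sum `F₃(h₀;h₁,h₂,h₃) = Γ(h₁)Γ(h₂)Γ(h₃)Γ(1+h₀−h₁−h₂−h₃)/(Γ(1+h₀−h₁−h₂)Γ(1+h₀−h₁−h₃)Γ(1+h₀−h₂−h₃))`; written with
the last parameter in Pochhammer normalisation (`Γ(h₃+μ)/Γ(1+h₀−h₃+μ) = Γ(h₃)/Γ(1+h₀−h₃)·(h₃)_μ/(1+h₀−h₃)_μ`) and evaluated at
`h₃ = −v`, `v ∈ ℕ`, it becomes the FINITE identity proved here from the Literature's terminating Dougall sum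
(`Literature.Combinatorics.Enumerative.dougall5F4_hypergeometric`, any field of characteristic zero — here `ℂ`) and the
shift `Γ(x+r) = Γ(x)·(x)_r` (`Gamma_add_nat_eq_mul_rf`):

`dougall_terminating_gamma`: for `h₀, h₁, h₂ : ℂ` off the poles (`h₀, h₀/2, h₁, h₂, h₀−h₁+1, h₀−h₂+1, h₀−h₁−h₂+1 ∉ −ℕ`)
and `v : ℕ`,
`Σ_{r ≤ v} (h₀+2r) · Γ(h₀+r)Γ(h₁+r)Γ(h₂+r)/(Γ(r+1)Γ(h₀−h₁+1+r)Γ(h₀−h₂+1+r)) · (−v)_r/(h₀+v+1)_r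
   = Γ(h₁)Γ(h₂)Γ(h₀+1+v)Γ(h₀−h₁−h₂+1+v)/(Γ(h₀−h₁−h₂+1)Γ(h₀−h₁+1+v)Γ(h₀−h₂+1+v))`,

`(x)_r = HypergeometricWhipple.rf x r = ∏_{i<r}(x+i)`.  Theorems only (no new definitions).
-/

noncomputable section

namespace Summit.KontsevichZagierPeriods.Zeta5Search.DougallTerminatingGamma

open Finset
open Summit.KontsevichZagierPeriods.Zeta5Search.HypergeometricWhipple (rf rf_zero rf_succ rf_add rf_eq_ascPochhammer_eval)

/-- Off the poles, `x + i ≠ 0` for every natural `i`. -/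
theorem add_nat_ne_zero {x : ℂ} (hx : ∀ n : ℕ, x ≠ -(n : ℂ)) (i : ℕ) : x + i ≠ 0 :=
  fun h => hx i (by linear_combination h)

/-- Off the poles, the rising factorial `(x)_r` does not vanish. -/
theorem rf_ne_zero {x : ℂ} (hx : ∀ n : ℕ, x ≠ -(n : ℂ)) (r : ℕ) : rf x r ≠ 0 := by
  unfold rf
  exact Finset.prod_ne_zero_iff.2 fun i _ => add_nat_ne_zero hx i

/-- **`Γ(x+r) = Γ(x)·(x)_r`** for `x` off the poles of `Γ`. -/
theorem Gamma_add_nat_eq_mul_rf {x : ℂ} (hx : ∀ n : ℕ, x ≠ -(n : ℂ)) (r : ℕ) :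
    Complex.Gamma (x + r) = Complex.Gamma x * rf x r := by
  induction r with
  | zero => simp [rf_zero]
  | succ r ih =>
    rw [Nat.cast_succ, ← add_assoc, Complex.Gamma_add_one _ (add_nat_ne_zero hx r), ih, rf_succ]
    ring

/-- `x · (x+1)_r = (x)_r · (x+r)`. -/
theorem mul_rf_succ_eq (x : ℂ) (r : ℕ) : x * rf (x + 1) r = rf x r * (x + r) := by
  have h1 : rf x (1 + r) = rf x 1 * rf (x + (1 : ℕ)) r := rf_add x 1 r
  have h2 : rf x 1 = x := by simp [rf]
  rw [Nat.cast_one, h2] at h1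
  rw [← h1, add_comm 1 r, rf_succ]

/-- The very-well-poised factor: `(h₀ + 2r)·(h₀/2)_r = h₀·(h₀/2+1)_r`. -/
theorem vwp_factor (h₀ : ℂ) (r : ℕ) : (h₀ + 2 * r) * rf (h₀ / 2) r = h₀ * rf (h₀ / 2 + 1) r := by
  have h := mul_rf_succ_eq (h₀ / 2) r
  linear_combination (-2 : ℂ) * h

/-- **Dougall's terminating very-well-poised `₅F₄` summation in Gamma form** (Zudilin math/0206177 (9) at `h₃ = −v`;
[cite: AndrewsAskeyRoy1999, §3.5, Cor. 3.5.2] [cite: Bailey1935, §4.4 (1)] with a negative-integer parameter): for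
`h₀, h₁, h₂` off the poles and `v ∈ ℕ`,
`Σ_{r ≤ v} (h₀+2r)·Γ(h₀+r)Γ(h₁+r)Γ(h₂+r)/(Γ(r+1)Γ(h₀−h₁+1+r)Γ(h₀−h₂+1+r))·(−v)_r/(h₀+v+1)_r
 = Γ(h₁)Γ(h₂)Γ(h₀+1+v)Γ(h₀−h₁−h₂+1+v)/(Γ(h₀−h₁−h₂+1)Γ(h₀−h₁+1+v)Γ(h₀−h₂+1+v))`. -/
theorem dougall_terminating_gamma (h₀ h₁ h₂ : ℂ) (v : ℕ)
    (H0 : ∀ n : ℕ, h₀ ≠ -(n : ℂ)) (H0' : ∀ n : ℕ, h₀ / 2 ≠ -(n : ℂ)) (H1 : ∀ n : ℕ, h₁ ≠ -(n : ℂ))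
    (H2 : ∀ n : ℕ, h₂ ≠ -(n : ℂ)) (H01 : ∀ n : ℕ, h₀ - h₁ + 1 ≠ -(n : ℂ)) (H02 : ∀ n : ℕ, h₀ - h₂ + 1 ≠ -(n : ℂ))
    (H012 : ∀ n : ℕ, h₀ - h₁ - h₂ + 1 ≠ -(n : ℂ)) :
    ∑ r ∈ range (v + 1), (h₀ + 2 * r) *
        (Complex.Gamma (h₀ + r) * Complex.Gamma (h₁ + r) * Complex.Gamma (h₂ + r)) /
          (Complex.Gamma ((r : ℂ) + 1) * Complex.Gamma (h₀ - h₁ + 1 + r) * Complex.Gamma (h₀ - h₂ + 1 + r)) *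
        (rf (-(v : ℂ)) r / rf (h₀ + v + 1) r) =
      Complex.Gamma h₁ * Complex.Gamma h₂ * Complex.Gamma (h₀ + 1 + v) * Complex.Gamma (h₀ - h₁ - h₂ + 1 + v) /
        (Complex.Gamma (h₀ - h₁ - h₂ + 1) * Complex.Gamma (h₀ - h₁ + 1 + v) * Complex.Gamma (h₀ - h₂ + 1 + v)) := by
  -- the pole bookkeeping
  have H0p1 : ∀ n : ℕ, h₀ + 1 ≠ -(n : ℂ) := fun n h => H0 (n + 1) (by push_cast; linear_combination h)
  have Hv : ∀ n : ℕ, h₀ + v + 1 ≠ -(n : ℂ) := fun n h => H0 (v + n + 1) (by push_cast; linear_combination h)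
  have hΓA : Complex.Gamma (h₀ - h₁ + 1) ≠ 0 := Complex.Gamma_ne_zero fun n => H01 n
  have hΓB : Complex.Gamma (h₀ - h₂ + 1) ≠ 0 := Complex.Gamma_ne_zero fun n => H02 n
  have hΓC : Complex.Gamma (h₀ - h₁ - h₂ + 1) ≠ 0 := Complex.Gamma_ne_zero fun n => H012 n
  have h0ne : h₀ ≠ 0 := by simpa using H0 0
  -- Dougall's terminating sum over `ℂ`, in `rf` form
  have key := Literature.Combinatorics.Enumerative.dougall5F4_hypergeometric (K := ℂ) h₀ h₁ h₂ v
    (fun r _ => by rw [← rf_eq_ascPochhammer_eval]; exact rf_ne_zero H0' r)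
    (fun r _ => by rw [← rf_eq_ascPochhammer_eval]; exact rf_ne_zero H01 r)
    (fun r _ => by rw [← rf_eq_ascPochhammer_eval]; exact rf_ne_zero H02 r)
    (fun r _ => by rw [← rf_eq_ascPochhammer_eval]; exact rf_ne_zero Hv r)
  simp only [← rf_eq_ascPochhammer_eval] at key
  -- the constant `T₀ = h₀ Γ(h₀)Γ(h₁)Γ(h₂)/(Γ(h₀−h₁+1)Γ(h₀−h₂+1))`
  set T₀ : ℂ := h₀ * Complex.Gamma h₀ * Complex.Gamma h₁ * Complex.Gamma h₂ /
    (Complex.Gamma (h₀ - h₁ + 1) * Complex.Gamma (h₀ - h₂ + 1)) with hT₀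
  -- termwise
  have hterm : ∀ r ∈ range (v + 1), (h₀ + 2 * r) *
        (Complex.Gamma (h₀ + r) * Complex.Gamma (h₁ + r) * Complex.Gamma (h₂ + r)) /
          (Complex.Gamma ((r : ℂ) + 1) * Complex.Gamma (h₀ - h₁ + 1 + r) * Complex.Gamma (h₀ - h₂ + 1 + r)) *
        (rf (-(v : ℂ)) r / rf (h₀ + v + 1) r) =
      T₀ * (rf h₀ r * rf (h₀ / 2 + 1) r * rf h₁ r * rf h₂ r * rf (-(v : ℂ)) r /
        ((r.factorial : ℂ) * rf (h₀ / 2) r * rf (h₀ - h₁ + 1) r * rf (h₀ - h₂ + 1) r * rf (h₀ + v + 1) r)) := by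
    intro r _
    have hr : (Complex.Gamma ((r : ℂ) + 1)) = (r.factorial : ℂ) := Complex.Gamma_nat_eq_factorial r
    rw [Gamma_add_nat_eq_mul_rf H0 r, Gamma_add_nat_eq_mul_rf H1 r, Gamma_add_nat_eq_mul_rf H2 r,
      Gamma_add_nat_eq_mul_rf H01 r, Gamma_add_nat_eq_mul_rf H02 r, hr, hT₀]
    have hfac : (r.factorial : ℂ) ≠ 0 := by exact_mod_cast r.factorial_ne_zero
    have h1 := rf_ne_zero H0' r
    have h2 := rf_ne_zero H01 r
    have h3 := rf_ne_zero H02 r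
    have h4 := rf_ne_zero Hv r
    have hv := vwp_factor h₀ r
    set P : ℂ := rf (h₀ / 2 + 1) r with hP
    set Q : ℂ := rf (h₀ / 2) r with hQ
    field_simp
    linear_combination (Complex.Gamma h₀ * rf h₀ r * Complex.Gamma h₁ * rf h₁ r * Complex.Gamma h₂ * rf h₂ r *
      rf (-(v : ℂ)) r) * hv
  rw [Finset.sum_congr rfl hterm, ← Finset.mul_sum, key, hT₀,
    Gamma_add_nat_eq_mul_rf H0p1 v, Gamma_add_nat_eq_mul_rf H012 v, Gamma_add_nat_eq_mul_rf H01 v,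
    Gamma_add_nat_eq_mul_rf H02 v, Complex.Gamma_add_one _ h0ne]
  have h5 := rf_ne_zero H01 v
  have h6 := rf_ne_zero H02 v
  field_simp

end Summit.KontsevichZagierPeriods.Zeta5Search.DougallTerminatingGamma

end
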